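import Mathlib
import Summits.Ventures.PercRepro2.UURefutation

/-!
# The control of the UU refutation: (HCOV) HOLDS on the bowtie witness, in the kernel
(blind cell PercRepro2, night-1 g34; proofs/NIGHT1-G34.md §0′ item 4, NEG-239 control)

`UURefutation.lean` refutes the UU inequality on the bowtie (`not_UUIneq`, `not_UU_all`).  This file
checks in the kernel that the crux's covariance form is NOT refuted there: with the same weights and
the same marks `(o, a₁, a₂, a₃, b) = (4, 0, 1, 3, 2)` (the core `A = 2` as the mark `b`),

  `Gc p ends 4 0 1 3 2 = 14419066389 / 244140625000000 > 0`,   i.e. `HCov p ends 4 0 1 3 2`.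

All thirty-four masses of the pattern events in `Gc` (units `10⁻⁶`, integer weights `wt`) are decided
by the kernel through the bitmask reachability of `ReachBits.decConnB` exactly as in `UURefutation`;
the value then follows by `norm_num`.  (The labelling gap `P(a₂ ↔ b) − P(a₁ ↔ b)` vanishes on this
symmetric witness: both masses are `924000`.)  Standard axioms; one seat.
-/

namespace Summit.Ventures.PercRepro2

namespace UURefutation

open UnionCluster CovForm

/-- Membership in the world events `T = {a₁ ∉ C₂, a₃ ∈ C₂}` / `T′` is decidable (fast). -/
instance instDecT (a₁ a₂ a₃ : Fin 5) : DecidablePred (· ∈ TEvent ends a₁ a₂ a₃) := fun ω =>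
  inferInstanceAs (Decidable (ω ∈ (connEvent ends a₂ a₁)ᶜ ∩ connEvent ends a₂ a₃))

section Masses

set_option maxRecDepth 100000
set_option maxHeartbeats 4000000

/-- `m(Q, a₁↔o, a₁↔b) = 5544`. -/
theorem mass_Q_oL_bL :
    MixedBox.mass wt (avoidAll ends 1 {0} ∩ (connEvent ends 0 4 ∩ connEvent ends 0 2)) = 5544 := by
  rw [CellMonoRefutation.mass_eq_sum6]; decide +kernel

/-- `m(Q, a₂↔o, a₂↔b) = 60648`. -/
theorem mass_Q_oH_bH :
    MixedBox.mass wt (avoidAll ends 1 {0} ∩ (connEvent ends 1 4 ∩ connEvent ends 1 2)) = 60648 := by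
  rw [CellMonoRefutation.mass_eq_sum6]; decide +kernel

/-- `m(Q, a₂↔o, a₁↔b) = 51744`. -/
theorem mass_Q_oH_bL :
    MixedBox.mass wt (avoidAll ends 1 {0} ∩ (connEvent ends 1 4 ∩ connEvent ends 0 2)) = 51744 := by
  rw [CellMonoRefutation.mass_eq_sum6]; decide +kernel

/-- `m(Q, a₁↔o, a₂↔b) = 0`. -/
theorem mass_Q_oL_bH :
    MixedBox.mass wt (avoidAll ends 1 {0} ∩ (connEvent ends 0 4 ∩ connEvent ends 1 2)) = 0 := by
  rw [CellMonoRefutation.mass_eq_sum6]; decide +kernel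

/-- `m(T′, a₁↔b) = 60648`. -/
theorem mass_Tp_bL : MixedBox.mass wt (TEvent ends 1 0 3 ∩ connEvent ends 0 2) = 60648 := by
  rw [CellMonoRefutation.mass_eq_sum6]; decide +kernel

/-- `m(T, a₂↔b) = 5544`. -/
theorem mass_T_bH : MixedBox.mass wt (TEvent ends 0 1 3 ∩ connEvent ends 1 2) = 5544 := by
  rw [CellMonoRefutation.mass_eq_sum6]; decide +kernel

/-- `m(T, a₁↔b) = 0`. -/
theorem mass_T_bL : MixedBox.mass wt (TEvent ends 0 1 3 ∩ connEvent ends 0 2) = 0 := by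
  rw [CellMonoRefutation.mass_eq_sum6]; decide +kernel

/-- `m(T′, a₂↔b) = 51744`. -/
theorem mass_Tp_bH : MixedBox.mass wt (TEvent ends 1 0 3 ∩ connEvent ends 1 2) = 51744 := by
  rw [CellMonoRefutation.mass_eq_sum6]; decide +kernel

/-- `m(T′, a₁↔o, a₁↔b) = 4788`. -/
theorem mass_Tp_oL_bL :
    MixedBox.mass wt (TEvent ends 1 0 3 ∩ (connEvent ends 0 4 ∩ connEvent ends 0 2)) = 4788 := by
  rw [CellMonoRefutation.mass_eq_sum6]; decide +kernel

/-- `m(T′, a₂↔o, a₁↔b) = 44688`. -/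
theorem mass_Tp_oH_bL :
    MixedBox.mass wt (TEvent ends 1 0 3 ∩ (connEvent ends 1 4 ∩ connEvent ends 0 2)) = 44688 := by
  rw [CellMonoRefutation.mass_eq_sum6]; decide +kernel

/-- `m(T, a₁↔o, a₂↔b) = 0`. -/
theorem mass_T_oL_bH :
    MixedBox.mass wt (TEvent ends 0 1 3 ∩ (connEvent ends 0 4 ∩ connEvent ends 1 2)) = 0 := by
  rw [CellMonoRefutation.mass_eq_sum6]; decide +kernel

/-- `m(T, a₂↔o, a₂↔b) = 4788`. -/
theorem mass_T_oH_bH :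
    MixedBox.mass wt (TEvent ends 0 1 3 ∩ (connEvent ends 1 4 ∩ connEvent ends 1 2)) = 4788 := by
  rw [CellMonoRefutation.mass_eq_sum6]; decide +kernel

/-- `m(T, a₁↔o, a₁↔b) = 0`. -/
theorem mass_T_oL_bL :
    MixedBox.mass wt (TEvent ends 0 1 3 ∩ (connEvent ends 0 4 ∩ connEvent ends 0 2)) = 0 := by
  rw [CellMonoRefutation.mass_eq_sum6]; decide +kernel

/-- `m(T, a₂↔o, a₁↔b) = 0`. -/
theorem mass_T_oH_bL :
    MixedBox.mass wt (TEvent ends 0 1 3 ∩ (connEvent ends 1 4 ∩ connEvent ends 0 2)) = 0 := by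
  rw [CellMonoRefutation.mass_eq_sum6]; decide +kernel

/-- `m(T′, a₁↔o, a₂↔b) = 0`. -/
theorem mass_Tp_oL_bH :
    MixedBox.mass wt (TEvent ends 1 0 3 ∩ (connEvent ends 0 4 ∩ connEvent ends 1 2)) = 0 := by
  rw [CellMonoRefutation.mass_eq_sum6]; decide +kernel

/-- `m(T′, a₂↔o, a₂↔b) = 44688`. -/
theorem mass_Tp_oH_bH :
    MixedBox.mass wt (TEvent ends 1 0 3 ∩ (connEvent ends 1 4 ∩ connEvent ends 1 2)) = 44688 := by
  rw [CellMonoRefutation.mass_eq_sum6]; decide +kernel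

/-- `m(T′) = 116648`. -/
theorem mass_Tp : MixedBox.mass wt (TEvent ends 1 0 3) = 116648 := by
  rw [CellMonoRefutation.mass_eq_sum6]; decide +kernel

/-- `m(T) = 5544`. -/
theorem mass_T : MixedBox.mass wt (TEvent ends 0 1 3) = 5544 := by
  rw [CellMonoRefutation.mass_eq_sum6]; decide +kernel

/-- `m(T′, a₁↔o) = 4788`. -/
theorem mass_Tp_oL : MixedBox.mass wt (TEvent ends 1 0 3 ∩ connEvent ends 0 4) = 4788 := by
  rw [CellMonoRefutation.mass_eq_sum6]; decide +kernel

/-- `m(T′, a₂↔o) = 92512`. -/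
theorem mass_Tp_oH : MixedBox.mass wt (TEvent ends 1 0 3 ∩ connEvent ends 1 4) = 92512 := by
  rw [CellMonoRefutation.mass_eq_sum6]; decide +kernel

/-- `m(T, a₁↔o) = 0`. -/
theorem mass_T_oL : MixedBox.mass wt (TEvent ends 0 1 3 ∩ connEvent ends 0 4) = 0 := by
  rw [CellMonoRefutation.mass_eq_sum6]; decide +kernel

/-- `m(T, a₂↔o) = 4788`. -/
theorem mass_T_oH : MixedBox.mass wt (TEvent ends 0 1 3 ∩ connEvent ends 1 4) = 4788 := by
  rw [CellMonoRefutation.mass_eq_sum6]; decide +kernel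

/-- `m(PD, a₁↔b) = 9576`. -/
theorem mass_PD_bL : MixedBox.mass wt (PDEvent ends 0 1 3 ∩ connEvent ends 0 2) = 9576 := by
  rw [CellMonoRefutation.mass_eq_sum6]; decide +kernel

/-- `m(PD, a₂↔b) = 12936`. -/
theorem mass_PD_bH : MixedBox.mass wt (PDEvent ends 0 1 3 ∩ connEvent ends 1 2) = 12936 := by
  rw [CellMonoRefutation.mass_eq_sum6]; decide +kernel

/-- `m(PD, a₁↔o, a₁↔b) = 756`. -/
theorem mass_PD_oL_bL :
    MixedBox.mass wt (PDEvent ends 0 1 3 ∩ (connEvent ends 0 4 ∩ connEvent ends 0 2)) = 756 := by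
  rw [CellMonoRefutation.mass_eq_sum6]; decide +kernel

/-- `m(PD, a₂↔o, a₁↔b) = 7056`. -/
theorem mass_PD_oH_bL :
    MixedBox.mass wt (PDEvent ends 0 1 3 ∩ (connEvent ends 1 4 ∩ connEvent ends 0 2)) = 7056 := by
  rw [CellMonoRefutation.mass_eq_sum6]; decide +kernel

/-- `m(PD, a₁↔o, a₂↔b) = 0`. -/
theorem mass_PD_oL_bH :
    MixedBox.mass wt (PDEvent ends 0 1 3 ∩ (connEvent ends 0 4 ∩ connEvent ends 1 2)) = 0 := by
  rw [CellMonoRefutation.mass_eq_sum6]; decide +kernel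

/-- `m(PD, a₂↔o, a₂↔b) = 11172`. -/
theorem mass_PD_oH_bH :
    MixedBox.mass wt (PDEvent ends 0 1 3 ∩ (connEvent ends 1 4 ∩ connEvent ends 1 2)) = 11172 := by
  rw [CellMonoRefutation.mass_eq_sum6]; decide +kernel

/-- `m(a₂ ↔ b) = 924000`. -/
theorem mass_conn_a2_b : MixedBox.mass wt (connEvent ends 1 2) = 924000 := by
  rw [CellMonoRefutation.mass_eq_sum6]; decide +kernel

/-- `m(a₁ ↔ b) = 924000`. -/
theorem mass_conn_a1_b : MixedBox.mass wt (connEvent ends 0 2) = 924000 := by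
  rw [CellMonoRefutation.mass_eq_sum6]; decide +kernel

end Masses

/-- **The crux's covariance form on the UU witness**: `Gc = 14419066389 / 244140625000000`. -/
theorem Gc_bowtie : Gc p ends 4 0 1 3 2 = 14419066389 / 244140625000000 := by
  simp only [Gc, DEF, EQbo, EQb3, EQb3o, EQo, EQ3, EQ3o, PDb, PDbo, Do, gap,
    MixedBox.prob_eq_mass_div weight_eq]
  rw [mass_Q, mass_PD, mass_PDo1, mass_PDo2, mass_Q_oL_bL, mass_Q_oH_bH, mass_Q_oH_bL, mass_Q_oL_bH,
    mass_Tp_bL, mass_T_bH, mass_T_bL, mass_Tp_bH, mass_Tp_oL_bL, mass_Tp_oH_bL, mass_T_oL_bH,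
    mass_T_oH_bH, mass_T_oL_bL, mass_T_oH_bL, mass_Tp_oL_bH, mass_Tp_oH_bH, mass_Tp, mass_T,
    mass_Tp_oL, mass_Tp_oH, mass_T_oL, mass_T_oH, mass_PD_bL, mass_PD_bH, mass_PD_oL_bL,
    mass_PD_oH_bL, mass_PD_oL_bH, mass_PD_oH_bH, mass_conn_a2_b, mass_conn_a1_b, mass_Qo1, mass_Qo2]
  norm_num

/-- **(HCOV) holds on the UU witness** (strictly): the bowtie refutes UU but not the crux. -/
theorem HCov_bowtie : HCov p ends 4 0 1 3 2 := by
  unfold HCov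
  rw [Gc_bowtie]
  norm_num

end UURefutation

end Summit.Ventures.PercRepro2
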